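import Summits.ValiantsHypothesis.ValiantsHypothesis.Theses.ProjectionStability
import Summits.ValiantsHypothesis.ValiantsHypothesis.Theorems.ProjectionRigidityProjOptimalUniqueRefutation
import Literature.Computability.AlgebraicComplexity.GrenetProjection

/-!
# `ProjectionStability.UniqBase` (stmt-ValiantsHypothesis-17836) is FALSE — planner evidence (crux-ideate seat)

`UniqBase` is, verbatim, the `n = 3` instance of the parent route's `ProjectionRigidity.ProjOptimalUnique`
(stmt-16001); transported along `pdc(per₃) = 7` (tree `detProjectionComplexity_perPoly_three`) it IS
`ProjectionRigidity.ProjOptimalUniqueThree` (stmt-16004), refuted in the tree at commit 616b35d018ac by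
`not_ProjOptimalUniqueThree` (Grenet's `7 × 7` projection `gA` and its purified single-syzygy Koszul twist
`K = P·gA·(1+D)·Q`, a `{0, ±1, X}`-valued pure projection with `det K = per₃` in a different
`GL₇(ℂ)² × permSymmetrySubst × ᵀ` class; `Theorems/ProjOptimalUnique/Negative/PurifiedTwist.lean`).
This file only re-assembles those tree theorems; a refuter/prover seat should land it under
`Theorems/` and close the item `refuted` (planners do not write Theorems).
-/

namespace Summit.ValiantsHypothesis.ValiantsHypothesis.Cruxes.UniqBase.Evidence

open Literature.Computability.AlgebraicComplexity
open Summit.ValiantsHypothesis.ValiantsHypothesis.Theses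

/-- `UniqBase` is literally `ProjOptimalUniqueThree` once `pdc(per₃) = 7` is rewritten. -/
theorem uniqBase_iff_projOptimalUniqueThree :
    ProjectionStability.UniqBase ↔ ProjectionRigidity.ProjOptimalUniqueThree := by
  unfold ProjectionStability.UniqBase ProjectionRigidity.ProjOptimalUniqueThree
  rw [detProjectionComplexity_perPoly_three]

/-- **¬ UniqBase**: the finite base of route ProjectionStability is refuted by the tree's purified twist. -/
theorem not_UniqBase : ¬ ProjectionStability.UniqBase := fun h =>
  Summit.ValiantsHypothesis.ValiantsHypothesis.Theorems.not_ProjOptimalUniqueThree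
    (uniqBase_iff_projOptimalUniqueThree.mp h)

end Summit.ValiantsHypothesis.ValiantsHypothesis.Cruxes.UniqBase.Evidence
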